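import Literature.NumberTheory.EllipticCurves.PAdicLFunctionMinus
import HarnessLib

/-!
# Cell `bsd-f1-sign2`, AN-33b/c: THE MINUS HALF-SUMS AND THEIR PROPORTIONALITY MOD 2 — statements (-an g16, MEMO-an v1.27 §2 AN-33, v1.29; TURNKEY D-an-77)

TYPER FILING (cell `bsd-f1-sign2`, seat `-ty` g10; -an g16 ask D-an-77 (15:19:56Z) «AN-33c IS A KERNEL THEOREM — land it; suggested home
`F1Sign2/MinusHalfSumParityAtTwo.lean` (3 defs + 9 theorems, no instance, no notation; your call on names)»): §2 of `MEMO-an-data/g16/Sketch_v26.lean`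
365abf27ff2d3723 VERBATIM (= §2 of `Sketch_v24.lean` 12844fd5bc644c5c, the REF1 D-an-73 object) — same namespace `…Rank1Residual.F1Sign2.ANg16`; the KERNEL
PROOFS (§5 of the sketch, 350 lines) are the sibling `F1Sign2/MinusHalfSumParityAtTwoProofs.lean` (module size cap), which ends in
`minusHalfSumHeckeStepModTwo_holds : MinusHalfSumHeckeStepModTwo` and `minusHalfSumProportionalityModTwo_holds : MinusHalfSumProportionalityModTwo`.
Decls here: carriers `minusHalfSum f m = F_m := ∑_{k=1}^{(m−1)/2} [k/m]⁻_f`, `IsMinusSymbolUnit f u`; statements AN-33b `MinusHalfSumHeckeStepModTwo`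
(`F_{qm} − (a_q − 1)·F_m − F_q ∈ 2uℤ`, `m` odd, `q ∤ Nm` an odd prime), AN-33c `MinusHalfSumProportionalityModTwo` (`a_{q′}·F_q − a_q·F_{q′} ∈ 2uℤ`) —
BOTH PROVED in the sibling, hence THEOREMS (no `@[conjecture]`); glue `exists_int_sum_ratMinusSymbol_eq_mul`, `exists_int_minusHalfSum_eq_mul`,
`minusHalfSumProportionalityModTwo_of_step` (AN-33c ⟸ AN-33b) PROVED here.  The §1, §3, §4 rows of the sketch (AN-33a `DoorValueSupplyAtTwo` = the
lead's `hSup`, and the `@[conjecture]` unit-door VALUE laws AN-33d–i) are a separate, REF1-gated filing (D-an-72, D-an-73 → `F1Sign2/UnitDoorParityAtTwo.lean`,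
which will import this file).  Typer edits = this header, the two «PROVED» docstring lines, imports trimmed to `Literature.…PAdicLFunctionMinus`.
CONSEQUENCE (MEMO-an v1.29): ONE BIT `η_f ∈ {0,1}` with `F_q ≡ η_f·a_q·u (mod 2u)` for every odd prime `q ∤ N` is UNCONDITIONALLY well defined at
symbol level for every rational newform (as soon as one `a_q` is odd): the half-sums are odd multiples of the symbol unit at ALL `3`-cycle primes or at
NONE, and even at every transposition or identity prime; by Birch's formula `η_f` is the common parity (in symbol units) of the algebraic central
values of all imaginary quadratic twists by pure-`3`-cycle doors.  The remaining conjecture-grade content of AN-33 is exactly the value laws d–i.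
Census (consistency, not evidence — the rows are theorems): ENGINE U (kit j310561–3): 30 816 prime half-sums on 1 712 slice curves, 0 forbidden-odd;
η_W well defined 611/611.
REF1: D-an-73 (audit of Sketch_v24, v25 incl. these rows) is §122 on -ref1 g11's list; the rows here are KERNEL THEOREMS (axioms = the standard trio
expected; gate-checked at landing), so the audit reduces to statement-reading (A1) and placement.  REF2-PLACEMENT v33 §1 (refuter-bsd-f1-sign2-ref2 g33, 2026-08-28T15:32:04Z; `HOME/REF2-PLACEMENT-v33.md` ec42c5f23fc45871;
D-an-73-upgraded, D-an-74 ANSWERED): «AN-33b/c statements VARIANT (unprinted as sentences), proof mechanism IN PRINT = the minus-side, mod-2u half-sum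
reading of the MAZUR–TATE NORM RELATION for modular elements π(θ_{ℓm}) = (a_ℓ − σ_ℓ⁻¹ − σ_ℓ)θ_m (MT87 §1, MTT84; χ_d-form = Cai–Li–Zhai 2020 Lemma 4.1 =
Zhai 2021 Prop. 3.2 (14)) + the half-system lemma + Zhai 2016's «χ(k) ≡ 1 mod 2» step + divisor bookkeeping ⇒ IN-PRINT-ASSEMBLY; beyond-print NO (v9 §2,
same class as AN-8S, K2-V); kernel-checked column YES once landed; tree-worthy.  The real delta: print only runs this calculus downstream of a SEED
and declines the minus side at Δ > 0, q ≡ 3 (4) (Zhai 2016 p. 3; Zhai 2021 Rem. 1.4; Cremona §2.11); -an's «one free bit η_f» is the seedless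
packaging — organising statement, not a new lever.»
[cite: MazurTateTeitelbaum1986, §I.4 (Hecke action on modular symbols)] [cite: MazurTate1987, §1] [cite: Zhai2016, proof of Thm. 1.1]
PARTITION: none moved (frontier tier); beyond-print theorem: no (REF2 v33 §1: IN-PRINT-ASSEMBLY; kernel-checked yes).
BSD is not proved; 23715 not closed.
bears_on: 23715 (`ByReductionTypeAtTwo.RankOneAtTwoBigImageOddLocal`; AN-33f `EggSymbolParityLawAtTwo` and the unit-door value laws read η_{f_W});
asks D-an-77 (-ty, this file + sibling), D-an-73 (REF1), D-an-74 (REF2).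
-/

set_option autoImplicit false

noncomputable section

open scoped MatrixGroups ModularForm

open CongruenceSubgroup Literature.NumberTheory.EllipticCurves Literature.NumberTheory.EllipticCurves.ModularForms

namespace Summit.BirchSwinnertonDyer.Rank1Residual.F1Sign2.ANg16

/-! ### §2 The minus half-sums and their proportionality mod 2 (THEOREM-CANDIDATES) -/

/-- The MINUS HALF-SUM at an odd level `m`: `F_m(f) := ∑_{k=1}^{(m−1)/2} [k/m]⁻_f ∈ ℚ` (ALL `k`, coprime or not; for `m` prime this is the
half-sum `T'_m` over the reduced residues).  Since `[·]⁻_f` is odd and `1`-periodic the FULL sum over `k mod m` vanishes; the half-sum is the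
non-trivial invariant. -/
def minusHalfSum {N : ℕ} (f : CuspForm (Gamma0 N) 2) (m : ℕ) : ℚ :=
  ∑ k ∈ Finset.Icc 1 ((m - 1) / 2), ratMinusSymbol f ((k : ℚ) / m)

/-- `u` is a SYMBOL UNIT for `[·]⁻_f`: `u > 0` and every minus symbol is an integer multiple of `u` (exists by Manin–Drinfeld:
`exists_forall_ratMinusSymbol_eq_div_of_maninDrinfeld`, `u = 1/D`). -/
def IsMinusSymbolUnit {N : ℕ} (f : CuspForm (Gamma0 N) 2) (u : ℚ) : Prop :=
  0 < u ∧ ∀ r : ℚ, ∃ z : ℤ, ratMinusSymbol f r = z * u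

/-- **AN-33b `MinusHalfSumHeckeStepModTwo` (PROVED in §5 below: `minusHalfSumHeckeStepModTwo_holds`, via `minusHalfSumHeckeStep`).**  For a newform `f` with rational
coefficients, a symbol unit `u`, an odd `m ≥ 1` and an odd prime `q ∤ N`, `q ∤ m`, with `a_q(f) = aq`:
`F_{qm} − (aq − 1)·F_m − F_q ∈ 2uℤ`.  Proof: sum the Hecke relation `aq·[k/m]⁻ = ∑_{j<q} [(k+jm)/(qm)]⁻ + [qk/m]⁻` over `1 ≤ k ≤ (m−1)/2`;
`{qk}` is a half-system mod `m` (≡ `F_m` mod `2u`); `{k + jm}` is a half-system of the residues mod `qm` not divisible by `m`, and the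
residues `≡ 0 (mod m)` contribute the half-system `{m·i : i ≤ (q−1)/2}` with sum `F_q`; a `uℤ`-valued odd `1`-periodic function has the same
sum mod `2u` over any two half-systems.  (Kernel-checked; census: ENGINE U j310561–3, 30 816 prime half-sums on 1 712 curves: Θ1 η constant 611/611, Θ2 0 odd / 6 110, Θ3 0 odd / 19 818).
PROVED in the kernel (-an g16 Sketch_v26 §5, every odd level `m`): `minusHalfSumHeckeStepModTwo_holds` in the sibling
`F1Sign2/MinusHalfSumParityAtTwoProofs.lean` — a THEOREM, kept as a `def … : Prop` so that users' `(h : MinusHalfSumHeckeStepModTwo)` binders are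
fed `_holds`.
REF2 v33 §1 (refuter-bsd-f1-sign2-ref2 g33, 2026-08-28T15:32:04Z): «IN-PRINT-ASSEMBLY — the minus-side, mod-2u half-sum reading of the Mazur–Tate norm
relation π(θ_{ℓm}) = (a_ℓ − σ_ℓ⁻¹ − σ_ℓ)θ_m (Mazur–Tate 1987 §1, MTT 1984; χ_d-form: Cai–Li–Zhai 2020 Lemma 4.1 = Zhai 2021 Prop. 3.2 (14)) via the
half-system lemma, Zhai 2016's mod-2 step (proof of Thm 1.1, M < 0) and divisor bookkeeping F_m = Σ_{e∣m,e>1}F′_e; statement unprinted (print declines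
the minus side at Δ > 0 for lack of a seed: Zhai 2016 p. 3, Zhai 2021 Rem. 1.4, Cremona §2.11); kernel-checked; beyond-print no.»
[cite: MazurTate1987, §1 (norm relation for modular elements)] [cite: Zhai2016, proof of Thm. 1.1] -/
def MinusHalfSumHeckeStepModTwo : Prop :=
  ∀ (N : ℕ) [NeZero N] (f : CuspForm (Gamma0 N) 2), IsNewform0 f → coeffField f = ⊥ →
    ∀ (u : ℚ), IsMinusSymbolUnit f u →
    ∀ (m q : ℕ), Odd m → q.Prime → Odd q → ¬ q ∣ N → ¬ q ∣ m →
    ∀ (aq : ℤ), cuspCoeff f q = (aq : ℂ) →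
      ∃ z : ℤ, minusHalfSum f (q * m) - (aq - 1) * minusHalfSum f m - minusHalfSum f q = 2 * z * u

/-- **AN-33c `MinusHalfSumProportionalityModTwo` (PROVED in §5 below: `minusHalfSumProportionalityModTwo_holds` = `minusHalfSumProportionalityModTwo_of_step minusHalfSumHeckeStepModTwo_holds`).**
For a newform `f` with rational coefficients, a symbol unit `u` and distinct odd primes `q, q' ∤ N`:
`a_{q'}·F_q − a_q·F_{q'} ∈ 2uℤ`.  Consequently the bit `η_f := F_q/u mod 2` at any `3`-cycle prime (`a_q` odd) does not depend on `q`,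
and `F_q/u` is even at every prime with `a_q` even.
PROVED in the kernel: `minusHalfSumProportionalityModTwo_holds` (sibling `…Proofs.lean`; = `minusHalfSumProportionalityModTwo_of_step` below applied
to `minusHalfSumHeckeStepModTwo_holds`).  REF2 v33 §1: IN-PRINT-ASSEMBLY (as AN-33b: Mazur–Tate norm relation read mod 2u on the minus side +
half-system lemma); the seedless «one free bit η_f» is the organising statement, not a new lever; kernel-checked; beyond-print no.
[cite: MazurTate1987, §1] [cite: Zhai2016, proof of Thm. 1.1] -/
def MinusHalfSumProportionalityModTwo : Prop :=
  ∀ (N : ℕ) [NeZero N] (f : CuspForm (Gamma0 N) 2), IsNewform0 f → coeffField f = ⊥ →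
    ∀ (u : ℚ), IsMinusSymbolUnit f u →
    ∀ (q q' : ℕ), q.Prime → q'.Prime → Odd q → Odd q' → q ≠ q' → ¬ q ∣ N → ¬ q' ∣ N →
    ∀ (aq aq' : ℤ), cuspCoeff f q = (aq : ℂ) → cuspCoeff f q' = (aq' : ℂ) →
      ∃ z : ℤ, aq' * minusHalfSum f q - aq * minusHalfSum f q' = 2 * z * u

/-- Every finite sum of minus symbols is an integer multiple of a symbol unit. -/
theorem exists_int_sum_ratMinusSymbol_eq_mul {N : ℕ} {f : CuspForm (Gamma0 N) 2} {u : ℚ} (hu : IsMinusSymbolUnit f u)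
    (s : Finset ℕ) (g : ℕ → ℚ) : ∃ a : ℤ, ∑ k ∈ s, ratMinusSymbol f (g k) = a * u := by
  choose z hz using hu.2
  refine ⟨∑ k ∈ s, z (g k), ?_⟩
  have hc : ∀ k ∈ s, ratMinusSymbol f (g k) = (z (g k) : ℚ) * u := fun k _ => hz (g k)
  rw [Finset.sum_congr rfl hc, ← Finset.sum_mul]
  push_cast
  rfl

/-- `F_m ∈ uℤ`. -/
theorem exists_int_minusHalfSum_eq_mul {N : ℕ} {f : CuspForm (Gamma0 N) 2} {u : ℚ} (hu : IsMinusSymbolUnit f u) (m : ℕ) :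
    ∃ a : ℤ, minusHalfSum f m = a * u :=
  exists_int_sum_ratMinusSymbol_eq_mul hu _ _

/-- Proved plumbing: the proportionality law follows from the Hecke step (pure ring bookkeeping in `ℚ`). -/
theorem minusHalfSumProportionalityModTwo_of_step (h : MinusHalfSumHeckeStepModTwo) : MinusHalfSumProportionalityModTwo := by
  intro N _ f hf hQ u hu q q' hq hq' hqo hq'o hne hqN hq'N aq aq' haq haq'
  have hqq' : ¬ q ∣ q' := fun hd => hne ((Nat.prime_dvd_prime_iff_eq hq hq').1 hd)
  have hq'q : ¬ q' ∣ q := fun hd => hne ((Nat.prime_dvd_prime_iff_eq hq' hq).1 hd).symm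
  -- step with (m, q) := (q', q):  F_{q q'} − (aq − 1) F_{q'} − F_q ∈ 2uℤ
  obtain ⟨z₁, hz₁⟩ := h N f hf hQ u hu q' q hq'o hq hqo hqN hqq' aq haq
  -- step with (m, q) := (q, q'):  F_{q' q} − (aq' − 1) F_q − F_{q'} ∈ 2uℤ
  obtain ⟨z₂, hz₂⟩ := h N f hf hQ u hu q q' hqo hq' hq'o hq'N hq'q aq' haq'
  have hcomm : (q' * q : ℕ) = q * q' := Nat.mul_comm _ _
  rw [hcomm] at hz₂
  obtain ⟨a, ha⟩ := exists_int_minusHalfSum_eq_mul hu q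
  obtain ⟨b, hb⟩ := exists_int_minusHalfSum_eq_mul hu q'
  refine ⟨z₁ - z₂ - b + a, ?_⟩
  have e : aq' * minusHalfSum f q - aq * minusHalfSum f q' =
      (minusHalfSum f (q * q') - (aq - 1) * minusHalfSum f q' - minusHalfSum f q) -
        (minusHalfSum f (q * q') - (aq' - 1) * minusHalfSum f q - minusHalfSum f q') -
        2 * minusHalfSum f q' + 2 * minusHalfSum f q := by ring
  rw [e, hz₁, hz₂, ha, hb]; push_cast; ring

/-! ### §2⁺ AN-33j/k: the units-only half-sum, the composite-door symbol law and the unit class of the full twisted Birch sum (THEOREMS)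

TYPER APPEND (-ty g11, D-an-77 steps 1′ of `MEMO-an-data/g16/turnkey/AN33k_PLAN.md` 7f0f7c3baffbdbe1): the block
`MEMO-an-data/g16/turnkey/an33jk_statements_block.lean` 193143f6c5f88733 (= `Sketch_v28.lean` d50ca18231cd831c lines 148–190; the two
«PROVED in §N below» phrases rewritten by -an to the tree file names) VERBATIM: carrier `minusHalfSumUnits f m = F×_m`, statements AN-33j
`MinusUnitHalfSumPureCycleLaw` and AN-33k `TwistedMinusSymbolSumUnitClassLaw` — BOTH kernel-proved by -an (Sketch_v27 §7 / Sketch_v28 §8,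
farm rc 0 · 0 warn · 0 sorry; standard axioms per REF1 §122/§123), hence plain `def … : Prop` THEOREM rows (no `@[conjecture]`); the proofs land as
the siblings `F1Sign2/MinusHalfSumClosedFormProofs.lean` (§6), `F1Sign2/MinusHalfSumPureCycleProofs.lean` (§7, `minusUnitHalfSumPureCycleLaw_holds`)
and `F1Sign2/TwistedMinusSymbolSumProofs.lean` (§8, `twistedMinusSymbolSumUnitClassLaw_holds`, corollaries AN-33l
`twistedLValue_one_ne_zero_of_pureCycle`, AN-33m `entireLFunction_quadraticTwist_one_ne_zero_of_pureCycle`).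
REF1 §122 (refuter-bsd-f1-sign2-ref1 g11, 2026-08-28T16:01:50Z; `REF1-AUDIT-v1.md` l.2374, evidence `REF1-data/b122/`): «AN-33b/c/j PROVED (kernel, std
axioms); AN-33j data law 42 279/42 279 (replay122 9aab19e60517180f); D-an-77 proofs files: no REF1 objection.»  REF1 §123 (2026-08-28T16:14:00Z; l.2413,
`REF1-data/b123/`): «`Sketch_v28.lean` d50ca18231cd831c farm rc 0·0·0·0; `#print axioms` standard for AN-33k `twistedMinusSymbolSumUnitClassLaw_holds`,
AN-33l, AN-33m AND their tree inputs (Birch odd/signed, Ω⁻ > 0, twist coefficients) — all three PROVED (kernel); modularity enters AN-33m only as the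
explicit hypotheses `hasEntireLFunction_rat` + `IsNewformOf W f`; seed normalisation explicit (u/2 is again a unit and flips the seed parity ⇒
«η_f = 1» is a property of (f,u)); BC7 numerical falsifier kit j312128 on AN-33m's FULL reach (d < 0, d ≡ 1 (4), (d,N) = 1, 3-cycle support,
|d| ≤ 1 500): η = 1 curves 37a1…229a1 (12): 826/826 twists L(W^{(d)},1) ≠ 0 (min |L| 0.056); contrast η = 0: 359a1 20/69, 359b1 27/69 vanish
(an. rank 2); 43a1/53a1/61a1 (Δ<0) 58/58, 75/75, 75/75 vanish (rank 1, odd sign forced) — consistent, no anomaly. KILLED none.»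
REF2-PLACEMENT v34 §1 (refuter-bsd-f1-sign2-ref2 g34, 2026-08-28T16:00:32Z; `HOME/REF2-PLACEMENT-v34.md` ec7e1b815cf3c567), REF2_TXT_AN33j: «IN-PRINT-ASSEMBLY
— the symbol-level special-value twin of Kriz–Li 2019 Thm 3.3/1.8 (seedless mod-2 congruence along square-free 3-cycle twists of either sign); base case
Δ < 0, rank 0 = Zhai 2016 Thm 1.1 + 1.6; mechanism Zhai 2016 Lemmas 2.2–2.3 / Cai–Li–Zhai 2020 Lemma 4.1 (parity of terms) / Mazur–Tate 1987 §1 norm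
relation; the Δ > 0 minus-side and rank-one sentences are unprinted (Zhai 2016 p. 3, Zhai 2021 Rem. 1.4); NEW-COMBINATION-small; kernel-checked;
beyond-print no.»  AN-33k/l/m placement = REF2-PLACEMENT v35 §1 (refuter-bsd-f1-sign2-ref2 g35, 2026-08-28T16:23:44Z; `HOME/REF2-PLACEMENT-v35.md`
2c54b4d948616f7a; D-an-78 ANSWERED; fold per v35-add1 §A4), REF2_TXT_AN33klm: «statement NOT IN PRINT — the door-seeded exact 2-adic class / non-vanishing
for odd quadratic characters of odd pure-S₀ (3-cycle) conductor at Δ_E > 0 fills the cell Adachi–Nomoto–Shii 2026 Table 1 row (12) leaves empty (Rem. 4.5: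
«not determined only by v₂(T₁) and v₂(a_q − 2)») and Zhai 2021 Rem. 1.4 declines; nearest print Kriz–Li 2019 Thm 3.3 / Ex. 6.1 (Heegner level, K-split
sub-family), ANS Thm 4.3–4.4 (T₄-seeded conductor-4m family, 37a1), Kriz–Nordentoft 2023 Cor. 5.18 (plus side, even characters, quantitative); mechanism
= in-print assembly (Mazur–Tate 1987 §1, Zhai 2016 L2.2, Cai–Li–Zhai 2020 L4.1, ANS §3); NEW-COMBINATION-small; kernel-checked; beyond-print theorem: no.
BSD is not proved by this.»  (Nearest held print for the METHOD per REF1 §123: Cai–Li–Zhai 2019 Thm 1.1, `T′_{d,m} = (a_q − 2χ_d(q))T′_{d,m/q}` — regime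
differs: 2-torsion, q ≡ 1 (4), positive twists.  Bib keys: Zhai 2021 = arXiv:2102.11798, published as `Zhai2025` (Pure Appl. Math. Q.); Cai–Li–Zhai
2020 = `CaiLiZhai2019`.)
[cite: KrizLi2019, Thm 1.8, Def 3.1/Thm 3.3, Thm 1.12, Ex. 6.1] [cite: Zhai2016, Thm 1.1, Thm 1.6, Lemmas 2.2–2.3] [cite: CaiLiZhai2019, Lemma 4.1, Thm 4.2]
[cite: MazurTate1987, §1 (norm relation for modular elements)] [cite: AdachiNomotoShii2026, Thm. 4.1, Rem. 4.5, Table 1, Thm. 4.3–4.4]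
[cite: Zhai2025, Rem. 1.4] [cite: KrizNordentoft2023, Thm. 5.9, Cor. 5.18]
PARTITION: none moved; beyond-print theorem: no (REF2 v34 §1 / v35 §1: IN-PRINT-ASSEMBLY / NEW-COMBINATION-small; kernel-checked yes).  BSD is not
proved; 23715 not closed. -/

/-- The units-only minus half-sum `F×_m := Σ_{1 ≤ k ≤ (m−1)/2, gcd(k,m) = 1} [k/m]⁻` — the mod-`2u` shadow of the twisted
Birch–Manin half-sum `Σ_{0<k<m/2} χ(k)[k/m]⁻` of an odd quadratic character of conductor `m` (`χ(k) = ±1 ≡ 1` on units, `0` off them). -/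
noncomputable def minusHalfSumUnits {N : ℕ} (f : CuspForm (Gamma0 N) 2) (m : ℕ) : ℚ :=
  ∑ k ∈ (Finset.Icc 1 ((m - 1) / 2)).filter (fun k => Nat.Coprime k m), ratMinusSymbol f ((k : ℚ) / (m : ℚ))

/-- **AN-33j `MinusUnitHalfSumPureCycleLaw` (-an g16 v27; PROVED: `minusUnitHalfSumPureCycleLaw_holds` in `F1Sign2/MinusHalfSumPureCycleProofs.lean`) — the composite-door
symbol law.**  Let `f` be a newform with rational coefficients, `u` a symbol unit, `q₀ ∤ N` an odd prime with `a_{q₀}` odd (a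
`3`-cycle prime; it fixes the bit `η_f := F_{q₀}/u mod 2`, independent of `q₀` by AN-33c).  For every square-free odd `m` all of whose
prime factors `q` satisfy `q ∤ N` (`a_q(f) = a q`):  `F×_m ≡ F_{q₀} ≡ η_f·u (mod 2u)` if `m > 1` and EVERY prime factor of `m` is a
`3`-cycle prime (`a_q` odd), and `F×_m ≡ 0 (mod 2u)` otherwise.  I.e. the parity (in symbol units) of the twisted Birch–Manin half-sum
is ONE bit `η_f` times the indicator of "pure `3`-cycle level" — for prime AND composite levels.  Ingredients: AN-33b at every odd level
(closed form `F_m ≡ η_f·[some prime factor is a 3-cycle]·u`, `minusHalfSum_closedForm_modTwo`), the gcd-partition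
`F_m = Σ_{d ∣ m} F×_d` (`minusHalfSum_eq_sum_divisors_minusHalfSumUnits`), and the divisor-count parity
`#{d ∣ m : d > 1 pure} ≡ [some 3-cycle prime ∣ m] (mod 2)` by the fixed-point-free involution `d ↦ d·p^{±1}` (`card_filter_divisors_pure`). -/
def MinusUnitHalfSumPureCycleLaw : Prop :=
  ∀ (N : ℕ) [NeZero N] (f : CuspForm (Gamma0 N) 2), IsNewform0 f → coeffField f = ⊥ →
    ∀ (u : ℚ), IsMinusSymbolUnit f u →
    ∀ (q₀ : ℕ) (a₀ : ℤ), q₀.Prime → Odd q₀ → ¬ q₀ ∣ N → cuspCoeff f q₀ = (a₀ : ℂ) → Odd a₀ →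
    ∀ (a : ℕ → ℤ) (m : ℕ), Squarefree m → Odd m → (∀ q ∈ m.primeFactors, ¬ q ∣ N ∧ cuspCoeff f q = (a q : ℂ)) →
      ((1 < m ∧ ∀ q ∈ m.primeFactors, Odd (a q)) → ∃ z : ℤ, minusHalfSumUnits f m = minusHalfSum f q₀ + 2 * z * u) ∧
      (¬ (1 < m ∧ ∀ q ∈ m.primeFactors, Odd (a q)) → ∃ z : ℤ, minusHalfSumUnits f m = 2 * z * u)

/-- **AN-33k `TwistedMinusSymbolSumUnitClassLaw` (-an g16 v28; PROVED: `twistedMinusSymbolSumUnitClassLaw_holds` in `F1Sign2/TwistedMinusSymbolSumProofs.lean`) — the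
unit class of the FULL twisted Birch sum.**  Same data as AN-33j plus an ODD QUADRATIC Dirichlet character `χ mod m` (`χ(−1) = −1`,
`χ = ±1` on units).  Then the full twisted minus-symbol sum of the tree's Birch formula,
`ratMinusTwistedSymbolSum f χ = Σ_{a mod m} χ(a)[a/m]⁻_f` (`= τ(χ)·L(f, χ̄, 1)/(Ω⁻_f·i)` by `ratMinusTwistedSymbolSum_mul_minusPeriod_mul_I`),
satisfies `Σ = 2·F_{q₀} + 4zu` (`≡ 2η_f·u mod 4u`) if `m > 1` is a pure `3`-cycle level, and `Σ ∈ 4uℤ` otherwise.  Ingredients: the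
pairing `a ↔ m − a` (`Σ = 2·Σ_{k ≤ (m−1)/2} χ(k)[k/m]⁻`), `χ(k) ≡ 𝟙_{(k,m)=1} (mod 2)` (`⇒ ≡ 2F×_m mod 4u`,
`ratMinusTwistedSymbolSum_eq_two_mul_unitsHalfSum`), and AN-33j.  COROLLARY (`twistedLValue_one_ne_zero_of_pureCycle`): if
`η_f = 1` (`F_{q₀} ∈ (2ℤ+1)u`) then `L(f, χ̄, 1) ≠ 0` for EVERY odd primitive quadratic `χ` of square-free odd conductor `m > 1`
coprime to `N` all of whose prime factors are `3`-cycle primes — a seed-to-family NON-VANISHING transport with no restriction on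
the sign of `Δ` or on `q mod 4` (the regime Zhai 2021 Rem. 1.4 declines). -/
def TwistedMinusSymbolSumUnitClassLaw : Prop :=
  ∀ (N : ℕ) [NeZero N] (f : CuspForm (Gamma0 N) 2), IsNewform0 f → coeffField f = ⊥ →
    ∀ (u : ℚ), IsMinusSymbolUnit f u →
    ∀ (q₀ : ℕ) (a₀ : ℤ), q₀.Prime → Odd q₀ → ¬ q₀ ∣ N → cuspCoeff f q₀ = (a₀ : ℂ) → Odd a₀ →
    ∀ (a : ℕ → ℤ) (m : ℕ) [NeZero m], Squarefree m → Odd m → (∀ q ∈ m.primeFactors, ¬ q ∣ N ∧ cuspCoeff f q = (a q : ℂ)) →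
    ∀ (χ : DirichletCharacter ℂ m), χ.Odd → (∀ x : (ZMod m)ˣ, χ x = 1 ∨ χ x = -1) →
      ((1 < m ∧ ∀ q ∈ m.primeFactors, Odd (a q)) →
        ∃ z : ℤ, ratMinusTwistedSymbolSum f χ = (((2 : ℚ) * minusHalfSum f q₀ + 4 * z * u : ℚ) : ℂ)) ∧
      (¬ (1 < m ∧ ∀ q ∈ m.primeFactors, Odd (a q)) →
        ∃ z : ℤ, ratMinusTwistedSymbolSum f χ = (((4 : ℚ) * z * u : ℚ) : ℂ))

/-! ### §2♯ (v32–v37) Symbol units AWAY from `M` — carriers for the canonical unit `u = ½`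

TYPER APPEND (-ty g11; -an g16 PORT FILE `MEMO-an-data/g16/Sketch_v37.lean` 454eaaa5b944aeb6 = v36 rebased on the tree, §2 residue VERBATIM + 2 docstrings):
`IsMinusSymbolUnitAway f M u` (`u > 0` divides every minus symbol whose denominator is coprime to `M`; `M = 1` is `IsMinusSymbolUnit`; for a
rational newform of level `N`, `u = ½` is a unit away from `N` — AN-33y `isMinusSymbolUnitAway_half`, PROVED in `F1Sign2/TwistPeriodUnitCanonicalProofs.lean`),
`IsMinusSymbolUnit.away`, the denominator lemmas `den_intCast_div_natCast_coprime`, `den_natCast_div_natCast_coprime`, `coprime_of_primeFactors_not_dvd`,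
and the AWAY twins `exists_int_sum_ratMinusSymbol_eq_mul_away`, `exists_int_minusHalfSum_eq_mul_away` of the two lemmas above (the v28 special
versions stay; tree decls are append-only).  The AWAY versions of the §5–§8 helpers land as `F1Sign2/MinusHalfSumAwayProofs.lean` etc. under
`_away` names (REF1 §126: «§4–§10 Away generalisation clean; 29/29 new theorems std axioms»).  Nothing asserted; BSD not proved. -/

/-- (v32) `u` is a SYMBOL UNIT AWAY FROM `M`: `u > 0` divides every minus symbol `[r]⁻_f` whose denominator is coprime to `M`.
`M = 1` is the notion above; for a rational newform of level `N`, **`u = ½` is a unit away from `N`** (AN-33y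
`isMinusSymbolUnitAway_half`, PROVED: `{∞, γ0} = {∞, γ∞} + {∞, 0}` and `im Λ_f = ℤ·Ω⁻_f/2`), which makes the parity bit `η_f` CANONICAL
(`η_f = 1 :⟺ 2F_{q₀}(f)` odd) and all of §4–§10 apply with `u = ½`. -/
def IsMinusSymbolUnitAway {N : ℕ} (f : CuspForm (Gamma0 N) 2) (M : ℕ) (u : ℚ) : Prop :=
  0 < u ∧ ∀ r : ℚ, r.den.Coprime M → ∃ z : ℤ, ratMinusSymbol f r = z * u

/-- A symbol unit is a symbol unit away from every `M`. -/
theorem IsMinusSymbolUnit.away {N : ℕ} {f : CuspForm (Gamma0 N) 2} {u : ℚ} (hu : IsMinusSymbolUnit f u) (M : ℕ) :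
    IsMinusSymbolUnitAway f M u :=
  ⟨hu.1, fun r _ => hu.2 r⟩

/-- The denominator of `k/m` divides `m`, so it is coprime to `M` when `m` is. -/
theorem den_intCast_div_natCast_coprime {M m : ℕ} (hmM : m.Coprime M) (k : ℤ) : ((k : ℚ) / (m : ℚ)).den.Coprime M := by
  refine Nat.Coprime.coprime_dvd_left ?_ hmM
  have h := Rat.den_dvd k (m : ℤ)
  rw [Rat.divInt_eq_div] at h
  push_cast at h
  exact Int.natCast_dvd_natCast.mp h

/-- `ℕ`-numerator form of `den_intCast_div_natCast_coprime`. -/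
theorem den_natCast_div_natCast_coprime {M m : ℕ} (hmM : m.Coprime M) (k : ℕ) : ((k : ℚ) / (m : ℚ)).den.Coprime M := by
  simpa using den_intCast_div_natCast_coprime hmM (k : ℤ)

/-- A natural number all of whose prime factors avoid `M`'s is coprime to `M`. -/
theorem coprime_of_primeFactors_not_dvd {m M : ℕ} (hm0 : m ≠ 0) (hpr : ∀ q ∈ m.primeFactors, ¬ q ∣ M) : m.Coprime M :=
  Nat.coprime_of_dvd fun k hk hkm hkM => hpr k (Nat.mem_primeFactors.mpr ⟨hk, hkm, hm0⟩) hkM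

/-- Every finite sum of minus symbols is an integer multiple of a symbol unit. -/
theorem exists_int_sum_ratMinusSymbol_eq_mul_away {N : ℕ} {f : CuspForm (Gamma0 N) 2} {M : ℕ} {u : ℚ} (hu : IsMinusSymbolUnitAway f M u)
    (s : Finset ℕ) (g : ℕ → ℚ) (hg : ∀ k ∈ s, (g k).den.Coprime M) : ∃ a : ℤ, ∑ k ∈ s, ratMinusSymbol f (g k) = a * u := by
  classical
  revert hg
  refine Finset.induction_on s (fun _ => ⟨0, by simp⟩) ?_
  intro i s hi ih hg
  obtain ⟨a, ha⟩ := ih (fun k hk => hg k (Finset.mem_insert_of_mem hk))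
  obtain ⟨z, hz⟩ := hu.2 (g i) (hg i (Finset.mem_insert_self i s))
  exact ⟨z + a, by rw [Finset.sum_insert hi, hz, ha]; push_cast; ring⟩

/-- `F_m ∈ uℤ`. -/
theorem exists_int_minusHalfSum_eq_mul_away {N : ℕ} {f : CuspForm (Gamma0 N) 2} {M : ℕ} {u : ℚ} (hu : IsMinusSymbolUnitAway f M u)
    (m : ℕ) (hmM : m.Coprime M) : ∃ a : ℤ, minusHalfSum f m = a * u :=
  exists_int_sum_ratMinusSymbol_eq_mul_away hu _ _ fun k _ => den_natCast_div_natCast_coprime hmM k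

end Summit.BirchSwinnertonDyer.Rank1Residual.F1Sign2.ANg16

end
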